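import Mathlib.RingTheory.FiniteType
import Literature.NumberTheory.Automorphic.HarishChandraGLIsomorphism
import Literature.NumberTheory.Automorphic.HarishChandraGLExistence
import HarnessLib

/-!
# The centre of `U(𝔤𝔩_n(𝕜))` is a finitely generated algebra (`𝕜 = ℝ` or `ℂ`)

Topic `NumberTheory/Automorphic`; a consequence of Harish-Chandra's isomorphism for `𝔤𝔩_n(𝕜)`
(`HarishChandraGLIsomorphism`: `ℂ ⊗_ℝ Z(U(𝔤𝔩_n(𝕜))) ≅ Z(U(∏_τ 𝔤𝔩_n(ℂ))) ≅ ℂ[x_{τ,i}]^{∏_τ 𝔖_n}`)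
and of the fundamental theorem of (block-)symmetric polynomials (`BlockSymmetric`):

* `finiteType_center_complexified` — `Z(U(∏_{τ : 𝕜 →ₐ[ℝ] ℂ} 𝔤𝔩_n(ℂ)))` is a finitely generated
  `ℂ`-algebra (the block elementary symmetric polynomials generate the block-symmetric ones,
  `BlockSymmetric.range_blockEsymmAeval`);
* `finiteType_center_real` — **`Z(U(𝔤𝔩_n(𝕜)))` is a finitely generated `ℝ`-algebra**
  (descent from the complexification: real and imaginary parts of generators of
  `ℂ ⊗_ℝ Z(U(𝔤𝔩_n(𝕜)))` generate, by the real part map `reT` of `HarishChandraGLIsomorphism`).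

Dixmier 1996, 7.4.5–7.4.6 (`Z(𝔤)` is a polynomial algebra for reductive `𝔤`); Knapp 2002,
Thm. 5.44. This is the input that turns "every central element acts algebraically" into "`Z(𝔤)`
acts through a finite-dimensional quotient" (an ideal of finite codimension), e.g. for the
`Z(𝔪)`-finiteness of constant terms (Moeglin–Waldspurger 1995, I.2.17, where `𝔷^M` finitely
generated over `i(𝔷)` is used together with the finite generation of `𝔷`). Everything here is
proved; theorems only, no definition, no named fact.

## References

* A. W. Knapp, *Lie Groups Beyond an Introduction*, 2nd ed. (2002), Thm. 5.44 [Knapp2002].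
* A. W. Knapp, D. A. Vogan, *Cohomological Induction and Unitary Representations* (1995), Thm. 4.95
  [KnappVogan1995].
* C. Moeglin, J.-L. Waldspurger, *Spectral decomposition and Eisenstein series* (1995), I.2.17
  [MoeglinWaldspurger1995].
-/

noncomputable section

-- Mathlib idiom (Mathlib/Algebra/Lie/OfAssociative.lean): commutator brackets on associative algebras
attribute [local instance 100] LieRing.ofAssociativeRing

open UniversalEnvelopingAlgebra TensorProduct

namespace Literature.NumberTheory.Automorphic

variable (𝕜 : Type*) [RCLike 𝕜] (n : ℕ)

local notation "Uℝ" => UniversalEnvelopingAlgebra ℝ (Matrix (Fin n) (Fin n) 𝕜)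
local notation "Uℂ" => UniversalEnvelopingAlgebra ℂ ((𝕜 →ₐ[ℝ] ℂ) → Matrix (Fin n) (Fin n) ℂ)

/-- **`Z(U(𝔤𝔩_n(𝕜))_ℂ)` is a finitely generated `ℂ`-algebra**: by Harish-Chandra's isomorphism it is
the algebra of `∏_τ 𝔖_n`-symmetric polynomials, generated by the block elementary symmetric
polynomials. Knapp 2002, Thm. 5.44; Dixmier 1996, 7.4.5. [cite: Knapp2002, Thm. 5.44] -/
theorem finiteType_center_complexified : Algebra.FiniteType ℂ (Subalgebra.center ℂ Uℂ) := by
  classical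
  set γ' := (harishChandraHomGL 𝕜 n).complexified with hγ'
  obtain ⟨hinj, hrange⟩ := (harishChandraHomGL 𝕜 n).complexified_injective_and_range_eq
  -- the block-symmetric subalgebra is finitely generated
  have hfg : Algebra.FiniteType ℂ (symmetricSubalgebraGL 𝕜 n) := by
    rw [symmetricSubalgebraGL_eq_blockSymmetricSubalgebra,
      ← Literature.RingTheory.MvPolynomial.BlockSymmetric.range_blockEsymmAeval]
    exact Algebra.FiniteType.of_surjective
      (Literature.RingTheory.MvPolynomial.BlockSymmetric.blockEsymmAeval (𝕜 →ₐ[ℝ] ℂ) n ℂ).rangeRestrict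
      (AlgHom.rangeRestrict_surjective _)
  -- transport along `γ' : Z ≃ range γ' = symmetric subalgebra`
  have e : Subalgebra.center ℂ Uℂ ≃ₐ[ℂ] symmetricSubalgebraGL 𝕜 n :=
    (AlgEquiv.ofInjective γ' hinj).trans (Subalgebra.equivOfEq _ _ hrange)
  exact hfg.equiv e.symm

/-- `ℂ ⊗_ℝ Z(U(𝔤𝔩_n(𝕜)))` is a finitely generated `ℝ`-algebra. [folklore] -/
theorem finiteType_tensor_center_real :
    Algebra.FiniteType ℝ (ℂ ⊗[ℝ] Subalgebra.center ℝ Uℝ) := by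
  have hC : Algebra.FiniteType ℂ (ℂ ⊗[ℝ] Subalgebra.center ℝ Uℝ) :=
    (finiteType_center_complexified 𝕜 n).equiv (centerEquiv 𝕜 n).symm
  have hRC : Algebra.FiniteType ℝ ℂ := inferInstance
  exact hRC.trans hC

/-- The real part of an element of `ℂ ⊗ Z'` (`Z'` a real subalgebra of the centre) lies in `Z'`.
[folklore] -/
theorem reT_map_mem (Z' : Subalgebra ℝ (Subalgebra.center ℝ Uℝ))
    (t : ℂ ⊗[ℝ] Z') :
    reT (Subalgebra.center ℝ Uℝ) (Algebra.TensorProduct.map (AlgHom.id ℂ ℂ) Z'.val t) ∈ Z' := by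
  induction t using TensorProduct.induction_on with
  | zero => rw [map_zero, map_zero]; exact Z'.zero_mem
  | tmul c z =>
    rw [Algebra.TensorProduct.map_tmul, AlgHom.id_apply, Subalgebra.coe_val, reT_tmul]
    exact Z'.smul_mem z.2 _
  | add x y hx hy => rw [map_add, map_add]; exact Z'.add_mem hx hy

/-- **`Z(U(𝔤𝔩_n(𝕜)))` is a finitely generated `ℝ`-algebra** (`𝕜 = ℝ` or `ℂ`): descent of
`finiteType_tensor_center_real` — the real and imaginary parts of a finite generating set of
`ℂ ⊗_ℝ Z(𝔤)` generate `Z(𝔤)`. Dixmier 1996, 7.4.5–7.4.6; Knapp 2002, Thm. 5.44.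
[cite: Knapp2002, Thm. 5.44] -/
theorem finiteType_center_real : Algebra.FiniteType ℝ (Subalgebra.center ℝ Uℝ) := by
  classical
  obtain ⟨s, hs⟩ := (finiteType_tensor_center_real 𝕜 n).out
  -- the real subalgebra generated by the real and imaginary parts of the generators
  set gens : Finset (Subalgebra.center ℝ Uℝ) :=
    s.image (reT (Subalgebra.center ℝ Uℝ)) ∪ s.image (imT (Subalgebra.center ℝ Uℝ)) with hgens
  set Z' : Subalgebra ℝ (Subalgebra.center ℝ Uℝ) := Algebra.adjoin ℝ (gens : Set (Subalgebra.center ℝ Uℝ)) with hZ'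
  -- `ℂ ⊗ Z'` surjects onto `ℂ ⊗ Z`
  set F := Algebra.TensorProduct.map (AlgHom.id ℂ ℂ) Z'.val with hF
  have hsub : ∀ x ∈ (s : Set (ℂ ⊗[ℝ] Subalgebra.center ℝ Uℝ)), x ∈ (F.restrictScalars ℝ).range := by
    intro x hx
    have hre : reT _ x ∈ Z' := Algebra.subset_adjoin (by
      rw [hgens, Finset.coe_union, Finset.coe_image, Finset.coe_image]
      exact Or.inl ⟨x, hx, rfl⟩)
    have him : imT _ x ∈ Z' := Algebra.subset_adjoin (by
      rw [hgens, Finset.coe_union, Finset.coe_image, Finset.coe_image]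
      exact Or.inr ⟨x, hx, rfl⟩)
    refine ⟨(1 : ℂ) ⊗ₜ ⟨reT _ x, hre⟩ + Complex.I ⊗ₜ ⟨imT _ x, him⟩, ?_⟩
    change F ((1 : ℂ) ⊗ₜ ⟨reT _ x, hre⟩ + Complex.I ⊗ₜ ⟨imT _ x, him⟩) = x
    rw [map_add, hF, Algebra.TensorProduct.map_tmul, Algebra.TensorProduct.map_tmul]
    exact tmul_reT_add_tmul_imT x
  have htop : (F.restrictScalars ℝ).range = ⊤ := by
    rw [eq_top_iff, ← hs]
    exact Algebra.adjoin_le hsub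
  -- hence `Z' = Z`
  have hZ'top : Z' = ⊤ := by
    rw [eq_top_iff]
    intro z _
    have hz : (1 : ℂ) ⊗ₜ[ℝ] z ∈ (F.restrictScalars ℝ).range := by rw [htop]; trivial
    obtain ⟨t, ht⟩ := hz
    change F t = (1 : ℂ) ⊗ₜ[ℝ] z at ht
    have h := reT_map_mem 𝕜 n Z' t
    rw [← hF, ht, reT_tmul, Complex.one_re, one_smul] at h
    exact h
  refine ⟨⟨gens, ?_⟩⟩
  rw [← hZ', hZ'top]

end Literature.NumberTheory.Automorphic
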